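import Mathlib.Algebra.Field.ZMod
import Literature.Computability.Complexity.CodeFPArith
import Literature.Computability.Complexity.CodeFPLists
import Literature.Computability.Complexity.GaussRankList
import HarnessLib

/-!
# Rank by Gaussian elimination, III: the list sweep over `𝔽_p` is polynomial time

Sequel of `GaussRank.lean` / `GaussRankList.lean` (the list sweep `GaussRank.lrank` with
`lrank_eq_finrank_span`). This file proves that, over the prime field `ZMod p`, the list sweep is
computed on codes by a polynomial-time string function, in the typed algebra `CodeFP` of
`CodeFP.lean` / `CodeFPLists.lean` / `CodeFPArith.lean` — the constructivity half of rank-based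
natural properties (first client: the Razborov–Smolensky property, `MetaComplexity/Smolensky*`):

* `zmodE p x = natE x.val` — residues coded by the binary numeral of their value; the field
  operations on codes: `zmodVal`, `zmodOfNat`, `zmodMul`, `zmodSub`, `zmodIsZero`;
* `codeFP_findStep`, `codeFP_lfind` (a fold with a constant-size accumulator), `codeFP_lelimRow`
  (`zipWith`), `codeFP_lstep` (`mapIdx`, `rawGetOr`), and the column loop `codeFP_lrun` — a fold
  whose accumulator (the flagged rows) stays LINEAR in the input because entries stay reduced
  mod `p` and rows never grow (`Dom`, `dom_lstep`, `length_stE_le`);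
* **`codeFP_lrank`**: `CodeFP (pairE unE (rawE (rowE p))) natE (fun s => lrank s.1 s.2)` — the rank
  of a list of rows over `𝔽_p` (row length given in unary) is computed on codes in polynomial time.

All statements are proved; no machine is written beyond the typed combinators.

## References

* S. Arora, B. Barak, *Computational Complexity: A Modern Approach*, CUP 2009, §1.3 (polynomial
  time is closed under composition and polynomially bounded loops) [AroraBarak2009].
* J. von zur Gathen, J. Gerhard, *Modern Computer Algebra*, 3rd ed., CUP 2013, §12.1 (Gaussian
  elimination over finite fields runs in polynomial time). (Schoolbook; proved here.)
-/

namespace Literature.Computability.Complexity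

namespace GaussRank

open _root_.Computability Polynomial CodeFP Brick

variable {p : ℕ} [Fact p.Prime]

/-! ### Residues mod `p` on codes -/

/-- The code of a residue: the binary numeral of its value in `[0, p)`. [folklore] -/
def zmodE (p : ℕ) : ZMod p → List Bool := fun x => natE x.val

/-- A row: the raw list of its residues. [folklore] -/
abbrev rowE (p : ℕ) : List (ZMod p) → List Bool := rawE (zmodE p)

/-- A flagged row. [folklore] -/
abbrev brE (p : ℕ) : Bool × List (ZMod p) → List Bool := pairE bitE (rowE p)

/-- A sweep state: the raw list of flagged rows. [folklore] -/
abbrev stE (p : ℕ) : List (Bool × List (ZMod p)) → List Bool := rawE (brE p)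

omit [Fact p.Prime] in
/-- Unfolding `zmodE`. [folklore] -/
theorem zmodE_apply (x : ZMod p) : zmodE p x = natE x.val := rfl

/-- `zmodE` is injective. [folklore] -/
theorem zmodE_injective : Function.Injective (zmodE p) := fun _ _ h =>
  ZMod.val_injective p (natE_injective h)

/-- The code of `0` is empty. [folklore] -/
theorem zmodE_zero : zmodE p 0 = [] := by
  rw [zmodE_apply, ZMod.val_zero]; rfl

omit [Fact p.Prime] in
/-- The value of a residue (the identity on codes). [folklore] -/
theorem zmodVal : CodeFP (zmodE p) natE ZMod.val :=
  recodeOut (CodeFP.id (zmodE p)) fun _ => rfl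

/-- Reduction of a numeral mod `p`. [folklore] -/
theorem zmodOfNat : CodeFP natE (zmodE p) (fun n : ℕ => (n : ZMod p)) :=
  recodeOut (g := fun n : ℕ => n % p) (natMod.comp ((CodeFP.id natE).pair (const natE p)))
    fun n => by rw [zmodE_apply, ZMod.val_natCast]

/-- Multiplication of residues. [folklore] -/
theorem zmodMul : CodeFP (pairE (zmodE p) (zmodE p)) (zmodE p) (fun q => q.1 * q.2) :=
  (zmodOfNat.comp (natMul.comp ((zmodVal.comp (fst _ _)).pair (zmodVal.comp (snd _ _))))).congr
    fun q => by push_cast; rw [ZMod.natCast_zmod_val, ZMod.natCast_zmod_val]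

/-- Subtraction of residues (`x - y = x + (p - y.val)` on values). [folklore] -/
theorem zmodSub : CodeFP (pairE (zmodE p) (zmodE p)) (zmodE p) (fun q => q.1 - q.2) :=
  (zmodOfNat.comp (natAdd.comp ((zmodVal.comp (fst _ _)).pair
    (natSub.comp ((const _ p).pair (zmodVal.comp (snd _ _))))))).congr fun q => by
    obtain ⟨x, y⟩ := q
    dsimp only
    rw [Nat.cast_add, Nat.cast_sub (ZMod.val_lt y).le, ZMod.natCast_zmod_val, ZMod.natCast_zmod_val,
      ZMod.natCast_self, zero_sub, sub_eq_add_neg]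

/-- The zero test. [folklore] -/
theorem zmodIsZero : CodeFP (zmodE p) bitE (fun x => decide (x = 0)) :=
  (CodeFP.eq zmodE_injective).comp ((CodeFP.id (zmodE p)).pair (const (zmodE p) (0 : ZMod p)))

/-! ### The search for the pivot row -/

/-- The step of the search fold on codes. [folklore] -/
theorem codeFP_findStep :
    CodeFP (pairE natE (pairE (brE p) (pairE bitE natE))) (pairE bitE natE)
      (fun t => findStep t.1 t.2.2 t.2.1) := by
  have hj : CodeFP (pairE natE (pairE (brE p) (pairE bitE natE))) natE (fun t => t.1) := fst _ _
  have hacc : CodeFP (pairE natE (pairE (brE p) (pairE bitE natE))) (pairE bitE natE) (fun t => t.2.2) :=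
    (snd _ _).snd'
  have hbr : CodeFP (pairE natE (pairE (brE p) (pairE bitE natE))) (brE p) (fun t => t.2.1) :=
    (snd _ _).fst'
  have hentry : CodeFP (pairE natE (pairE (brE p) (pairE bitE natE))) (zmodE p)
      (fun t => t.2.1.2.getD t.1 0) :=
    (rawGetD (zmodE p) (d := (0 : ZMod p)) zmodE_zero).comp (hbr.snd'.pair hj)
  have hcand : CodeFP (pairE natE (pairE (brE p) (pairE bitE natE))) bitE (fun t => cand t.1 t.2.1) :=
    (hbr.fst'.not.and (zmodIsZero.comp hentry).not).congr fun t => by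
      simp only [cand, decide_not]
  exact (hacc.fst'.ite hacc ((hcand.ite ((const _ true).pair hacc.snd')
    ((const _ false).pair (natAdd.comp (hacc.snd'.pair (const _ 1))))))).congr fun t => by
      unfold findStep
      split_ifs <;> rfl

/-- The index counter of the search fold is bounded by the start plus the length. [folklore] -/
theorem foldl_findStep_snd_le (j : ℕ) (l : List (Bool × List (ZMod p))) (acc : Bool × ℕ) :
    (l.foldl (findStep j) acc).2 ≤ acc.2 + l.length := by
  induction l generalizing acc with
  | nil => simp
  | cons br l ih =>
    rw [List.foldl_cons, List.length_cons]
    have hstep : (findStep j acc br).2 ≤ acc.2 + 1 := by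
      unfold findStep
      split_ifs <;> simp
    have := ih (findStep j acc br)
    omega

/-- **The pivot search on codes**: `(j, rows) ↦ lfind j rows`. [folklore] -/
theorem codeFP_lfind : CodeFP (pairE natE (stE p)) natE (fun q => lfind q.1 q.2) := by
  have h := foldl (σ := ℕ) (α := Bool × List (ZMod p)) (β := Bool × ℕ) (eσ := natE) (eα := brE p)
    (eβ := pairE bitE natE) (step := fun j br acc => findStep j acc br) (init := fun _ => (false, 0))
    codeFP_findStep (const natE (false, 0)) (X + 4) (fun j l₁ l₂ => by
      have hb := foldl_findStep_snd_le j l₁ (false, 0)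
      set acc := l₁.foldl (fun acc br => findStep j acc br) (false, 0) with hacc
      rw [pairE_apply, length_boolPair, eval_add, eval_X, eval_ofNat, pairE_apply, length_boolPair]
      have h1 : (natE acc.2).length ≤ acc.2 := length_natE_le _
      have h2 : l₁.length ≤ (rawE (brE p) (l₁ ++ l₂)).length :=
        le_trans (by simp) (length_le_length_rawE _ _)
      simp only [bitE, List.length_singleton] at *
      omega)
  exact h.snd'.congr fun q => rfl

/-! ### Elimination of a row and of a column -/

/-- **One row against the pivot on codes**: `(j, piv, r) ↦ lelimRow j piv r`. [folklore] -/
theorem codeFP_lelimRow :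
    CodeFP (pairE natE (pairE (rowE p) (rowE p))) (rowE p) (fun t => lelimRow t.1 t.2.1 t.2.2) := by
  have hg : CodeFP (pairE (pairE (zmodE p) (zmodE p)) (pairE (zmodE p) (zmodE p))) (zmodE p)
      (fun t => t.1.1 * t.2.1 - t.1.2 * t.2.2) :=
    zmodSub.comp ((zmodMul.comp ((fst _ _).fst'.pair (snd _ _).fst')).pair
      (zmodMul.comp ((fst _ _).snd'.pair (snd _ _).snd')))
  have hz := zipWith (σ := ZMod p × ZMod p) (eσ := pairE (zmodE p) (zmodE p)) (eα := zmodE p)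
    (eβ := zmodE p) (eγ := zmodE p) (g := fun t => t.1.1 * t.2.1 - t.1.2 * t.2.2) hg
  -- the context `(piv_j, r_j)` and the argument pair `(r, piv)`
  have hj : CodeFP (pairE natE (pairE (rowE p) (rowE p))) natE (fun t => t.1) := fst _ _
  have hpiv : CodeFP (pairE natE (pairE (rowE p) (rowE p))) (rowE p) (fun t => t.2.1) := (snd _ _).fst'
  have hr : CodeFP (pairE natE (pairE (rowE p) (rowE p))) (rowE p) (fun t => t.2.2) := (snd _ _).snd'
  have hg0 := rawGetD (zmodE p) (d := (0 : ZMod p)) zmodE_zero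
  have hctx : CodeFP (pairE natE (pairE (rowE p) (rowE p))) (pairE (zmodE p) (zmodE p))
      (fun t => (t.2.1.getD t.1 0, t.2.2.getD t.1 0)) :=
    (hg0.comp (hpiv.pair hj)).pair (hg0.comp (hr.pair hj))
  exact (hz.comp (hctx.pair (hr.pair hpiv))).congr fun t => rfl

/-- The row map of `lstep` on codes, with context `(j, i₀, piv)`. [folklore] -/
theorem codeFP_lstepRow :
    CodeFP (pairE (pairE natE (pairE natE (rowE p))) (pairE natE (brE p))) (brE p)
      (fun t => if decide (t.2.1 = t.1.2.1) then (true, t.2.2.2)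
        else (t.2.2.1, lelimRow t.1.1 t.1.2.2 t.2.2.2)) := by
  have hc : CodeFP (pairE (pairE natE (pairE natE (rowE p))) (pairE natE (brE p)))
      (pairE natE (pairE natE (rowE p))) (fun t => t.1) := fst _ _
  have ha : CodeFP (pairE (pairE natE (pairE natE (rowE p))) (pairE natE (brE p)))
      (pairE natE (brE p)) (fun t => t.2) := snd _ _
  refine (natEq.comp (ha.fst'.pair hc.snd'.fst')).ite ((const _ true).pair ha.snd'.snd') ?_
  exact ha.snd'.fst'.pair (codeFP_lelimRow.comp (hc.fst'.pair (hc.snd'.snd'.pair ha.snd'.snd')))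

/-- **One column of the sweep on codes**: `(j, rows) ↦ lstep rows j`. [folklore] -/
theorem codeFP_lstep : CodeFP (pairE natE (stE p)) (stE p) (fun q => lstep q.2 q.1) := by
  have hj : CodeFP (pairE natE (stE p)) natE (fun q => q.1) := fst _ _
  have hst : CodeFP (pairE natE (stE p)) (stE p) (fun q => q.2) := snd _ _
  have hi₀ : CodeFP (pairE natE (stE p)) natE (fun q => lfind q.1 q.2) := codeFP_lfind
  have hlen : CodeFP (pairE natE (stE p)) natE (fun q => q.2.length) := (natLength (brE p)).comp hst
  have hcond : CodeFP (pairE natE (stE p)) bitE (fun q => decide (lfind q.1 q.2 < q.2.length)) :=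
    natLt.comp (hi₀.pair hlen)
  have hpiv : CodeFP (pairE natE (stE p)) (rowE p)
      (fun q => (q.2.getD (lfind q.1 q.2) (false, [])).2) :=
    ((rawGetOr (brE p)).comp (hst.pair (hi₀.pair (const _ ((false, []) : Bool × List (ZMod p)))))).snd'
  have hmap := (CodeFP.mapIdx codeFP_lstepRow).comp ((hj.pair (hi₀.pair hpiv)).pair hst)
  refine (hcond.ite hmap hst).congr fun q => ?_
  obtain ⟨j, rows⟩ := q
  simp only [lstep, decide_eq_true_eq]

/-! ### The column loop: the accumulator stays linear -/

/-- The bound on the code of a reduced entry: the length of the numeral `p - 1`. [folklore] -/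
def entryLen (p : ℕ) : ℕ := (natE (p - 1)).length

/-- Every residue has a short code. [folklore] -/
theorem length_zmodE_le (x : ZMod p) : (zmodE p x).length ≤ entryLen p := by
  rw [zmodE_apply, entryLen]
  exact length_encodeNat_mono (Nat.le_sub_one_of_lt (ZMod.val_lt x))

/-- A row code is at most `|r| · (2·entryLen + 2)`. [folklore] -/
theorem length_rowE_le (r : List (ZMod p)) : (rowE p r).length ≤ r.length * (2 * entryLen p + 2) := by
  induction r with
  | nil => simp [rowE, rawE]
  | cons x r ih =>
    have hx := length_zmodE_le x
    have h : rowE p (x :: r) = boolPair (zmodE p x) (rowE p r) := rawE_cons _ _ _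
    rw [h, length_boolPair, List.length_cons]
    nlinarith

omit [Fact p.Prime] in
/-- A row code is at least twice the row length. [folklore] -/
theorem two_mul_length_le_length_rowE (r : List (ZMod p)) : 2 * r.length ≤ (rowE p r).length := by
  induction r with
  | nil => simp
  | cons x r ih =>
    have h : rowE p (x :: r) = boolPair (zmodE p x) (rowE p r) := rawE_cons _ _ _
    rw [h, length_boolPair, List.length_cons]
    omega

/-- **Row-length domination**: state `st` is dominated by the input rows `rows` (same count, no
row longer than the corresponding input row). [folklore] -/
def Dom (st : List (Bool × List (ZMod p))) (rows : List (List (ZMod p))) : Prop :=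
  List.Forall₂ (fun br r => br.2.length ≤ r.length) st rows

omit [Fact p.Prime] in
/-- The initial state is dominated. [folklore] -/
theorem dom_init (rows : List (List (ZMod p))) : Dom (rows.map fun r => (false, r)) rows := by
  unfold Dom
  induction rows with
  | nil => exact List.Forall₂.nil
  | cons r rows ih => exact List.Forall₂.cons le_rfl ih

/-- `lstep` preserves domination (rows are replaced by `zipWith`s against themselves). [folklore] -/
theorem dom_lstep {st : List (Bool × List (ZMod p))} {rows : List (List (ZMod p))} (h : Dom st rows)
    (j : ℕ) : Dom (lstep st j) rows := by
  unfold lstep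
  split_ifs with hlt
  · unfold Dom at h ⊢
    rw [List.forall₂_iff_get] at h ⊢
    refine ⟨by rw [List.length_mapIdx]; exact h.1, fun i h₁ h₂ => ?_⟩
    have h₁' : i < st.length := by simpa using h₁
    have hle := h.2 i h₁' h₂
    simp only [List.get_eq_getElem, List.getElem_mapIdx] at hle ⊢
    split_ifs
    · exact hle
    · refine le_trans ?_ hle
      simp only [lelimRow, List.length_zipWith]
      exact min_le_left _ _
  · exact h

/-- The column loop preserves domination. [folklore] -/
theorem dom_foldl {rows : List (List (ZMod p))} (l : List ℕ) {st : List (Bool × List (ZMod p))}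
    (h : Dom st rows) : Dom (l.foldl lstep st) rows := by
  induction l generalizing st with
  | nil => exact h
  | cons j l ih => exact ih (dom_lstep h j)

/-- **A dominated state has a code linear in the code of the input rows.** [folklore] -/
theorem length_stE_le {st : List (Bool × List (ZMod p))} {rows : List (List (ZMod p))}
    (h : Dom st rows) : (stE p st).length ≤ (entryLen p + 5) * (rawE (rowE p) rows).length := by
  unfold Dom at h
  induction h with
  | nil => simp
  | @cons br r st rows hle _ ih =>
    have h1 : stE p (br :: st) = boolPair (brE p br) (stE p st) := rawE_cons _ _ _
    have h2 : rawE (rowE p) (r :: rows) = boolPair (rowE p r) (rawE (rowE p) rows) := rawE_cons _ _ _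
    rw [h1, h2, length_boolPair, length_boolPair]
    have h3 : (brE p br).length = 4 + (rowE p br.2).length := by
      rw [show brE p br = boolPair (bitE br.1) (rowE p br.2) from pairE_apply _ _ _, length_boolPair]
      simp [bitE]
    have h4 := length_rowE_le (p := p) br.2
    have h5 := two_mul_length_le_length_rowE (p := p) r
    rw [h3]
    have h6 : (rowE p br.2).length ≤ r.length * (2 * entryLen p + 2) :=
      h4.trans (Nat.mul_le_mul_right _ hle)
    nlinarith

/-- **The column loop on codes**: `(N, rows) ↦ lrun N (rows with cleared flags)`. [folklore] -/
theorem codeFP_lrun :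
    CodeFP (pairE unE (rawE (rowE p))) (stE p) (fun s => lrun s.1 (s.2.map fun r => (false, r))) := by
  have hstep : CodeFP (pairE (pairE unE (rawE (rowE p))) (pairE natE (stE p))) (stE p)
      (fun t => lstep t.2.2 t.2.1) := codeFP_lstep.comp (snd _ _)
  have hinit : CodeFP (pairE unE (rawE (rowE p))) (stE p) (fun s => s.2.map fun r => (false, r)) :=
    (map₀ ((const (rowE p) false).pair (CodeFP.id (rowE p)))).comp (snd _ _)
  have h := foldl (σ := ℕ × List (List (ZMod p))) (α := ℕ) (β := List (Bool × List (ZMod p)))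
    (eσ := pairE unE (rawE (rowE p))) (eα := natE) (eβ := stE p)
    (step := fun _ j st => lstep st j) (init := fun s => s.2.map fun r => (false, r)) hstep hinit
    (C (entryLen p + 5) * X) (fun s l₁ l₂ => by
      have hdom := dom_foldl l₁ (dom_init s.2)
      refine (length_stE_le hdom).trans ?_
      rw [eval_mul, eval_C, eval_X]
      refine Nat.mul_le_mul_left _ ?_
      obtain ⟨N, rows⟩ := s
      simp only [pairE_apply, length_boolPair]
      omega)
  exact (h.comp ((CodeFP.id _).pair (urange.comp (fst _ _)))).congr fun s => rfl

/-! ### Counting the flags and the rank -/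

omit [Fact p.Prime] in
/-- The counting fold is `countP`. [folklore] -/
theorem foldl_count_eq_countP (l : List (Bool × List (ZMod p))) (k : ℕ) :
    l.foldl (fun k br => if br.1 then k + 1 else k) k = k + l.countP fun br => br.1 := by
  induction l generalizing k with
  | nil => simp
  | cons br l ih =>
    rw [List.foldl_cons, ih, List.countP_cons]
    cases br.1 <;> simp; omega

omit [Fact p.Prime] in
/-- Counting the flags on codes. [folklore] -/
theorem codeFP_countFlags : CodeFP (stE p) natE (fun st => st.countP fun br => br.1) := by
  have hstep : CodeFP (pairE (brE p) natE) natE (fun t => if t.1.1 then t.2 + 1 else t.2) :=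
    (fst _ _).fst'.ite (natAdd.comp ((snd _ _).pair (const _ 1))) (snd _ _)
  have h := foldl₀ (α := Bool × List (ZMod p)) (β := ℕ) (eα := brE p) (eβ := natE)
    (step := fun br k => if br.1 then k + 1 else k) (b₀ := 0) hstep X (fun l₁ l₂ => by
      rw [foldl_count_eq_countP, Nat.zero_add, eval_X]
      exact (length_natE_le _).trans ((List.countP_le_length).trans
        (le_trans (by simp) (length_le_length_rawE _ _))))
  exact h.congr fun l => by rw [foldl_count_eq_countP, Nat.zero_add]

/-- **The rank of a list of rows over `𝔽_p` is computed on codes in polynomial time** (row length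
in unary, rows as raw lists of residues). [cite: AroraBarak2009, §1.3] -/
theorem codeFP_lrank : CodeFP (pairE unE (rawE (rowE p))) natE (fun s => lrank s.1 s.2) :=
  (codeFP_countFlags.comp codeFP_lrun).congr fun _ => rfl

end GaussRank

end Literature.Computability.Complexity
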